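import Literature.AlgebraicGeometry.Frobenioids.EquivalencePreStepsFSMFF2008Assembly
import Literature.AlgebraicGeometry.Frobenioids.PerfectionSquareFSMFF2024
import Literature.AlgebraicGeometry.Frobenioids.BirationalizationCor410FSMFF2024
import HarnessLib

/-!
# Frobenioids I, §3–§4 consequences of Theorem 3.4 (ii) AS PRINTED (bases of FSMFF-type in the 2008 sense)

Mochizuki, *The geometry of Frobenioids I: the general theory*, Kyushu J. Math. **62** (2008) 293–400,
Thm. 3.4 (ii), (iii) pp. 62–63, Cor. 4.10 p. 90
[cite: MochizukiFrdI2008, Thm. 3.4 (ii) p.62].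

PROOF-ONLY file (seat abc-iut-L1-t13; no definitions). With Thm. 3.4 (ii) now a theorem over bases of
FSMFF-type AS PRINTED (`EquivalencePreStepsFSMFF2008.lean`, `EquivalencePreStepsFSMFF2008Assembly.lean`:
`FrdI.isPreStep_map_of_quasiIsotropic_of_isOfFSMFFType`, `FrdI.Thm34ii_holds`), every result of §3–§4 that
the cell had closed "modulo `Ψ`, `Ψ⁻¹` preserve pre-steps" or "over bases of FSMFF-type in the revised
(2024) sense" holds over bases of FSMFF-type in the printed sense — and, where the typed statement carries
"standard type" (whose clause (d) IS the printed notion, `PreFrobenioidData.IsOfStandardType.fsmff`) or the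
printed FSMFF antecedents themselves, with NO base hypothesis at all. This file records the one-line
instantiations:

* (Thm. 4.2 (i), (ii), (iii) AS TYPED at `ofFunctor` with no base hypothesis are seat abc-iut-L1-t11's
  `FrdI.T42.thm42i_ofFunctor` & co. in `Thm34AsPrintedConsequences.lean`, not repeated here);
* (Thm. 4.9 AS TYPED and with its compatibility clause, no base hypothesis, are seat abc-iut-f-027's
  `FrdI.T49.thm49_ofFunctor` / `exists_thm49_compat_ofFunctor` in `Thm49AsPrinted.lean`, not repeated here);
* Thm. 3.4 (iii), perfection square, over printed-FSMFF bases (`FrdI.isFrobeniusCompatible_of_isOfFSMFFType`,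
  `FrdI.thm34iii_pfSquare_of_isOfFSMFFType`, `FrdI.perfectionMap_isEquivalence_of_isOfFSMFFType`);
* steps are preserved over printed-FSMFF bases (`FrdI.isStep_map_of_isOfFSMFFType`);
* Cor. 4.10 AS TYPED at THE birationalizations, no residual input (`PreFrobenioid.cor410_biratData_asPrinted`).
No statement of the paper is restated or strengthened; nothing here bears on [IUTchIII].
-/

set_option backward.isDefEq.respectTransparency false

namespace Literature.AlgebraicGeometry.Frobenioids

open CategoryTheory Opposite

universe w v v' u u'

/-! ### Steps and the perfection square over printed-FSMFF bases -/

namespace FrdI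

section Two

variable {D₁ : Type u} [Category.{v} D₁] {Φ₁ : D₁ᵒᵖ ⥤ CommMonCat.{w}} {C₁ : Type u'}
  [Category.{v'} C₁] {D₂ : Type u} [Category.{v} D₂] {Φ₂ : D₂ᵒᵖ ⥤ CommMonCat.{w}} {C₂ : Type u'}
  [Category.{v'} C₂] {F₁ : C₁ ⥤ ElemFrobenioid Φ₁} {F₂ : C₂ ⥤ ElemFrobenioid Φ₂}

/-- Over a target base of FSMFF-type AS PRINTED and Frobenioids of isotropic type, `Ψ` maps steps to steps
(Thm. 3.4 (ii) + reflection of isomorphisms). [cite: MochizukiFrdI2008, Thm. 3.4 (ii) p.62] -/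
theorem isStep_map_of_isOfFSMFFType (hF₁ : PreFrobenioid.IsFrobenioid F₁)
    (hF₂ : PreFrobenioid.IsFrobenioid F₂) (hi₁ : PreFrobenioid.IsOfIsotropicType F₁)
    (hi₂ : PreFrobenioid.IsOfIsotropicType F₂) (hD₂ : IsOfFSMFFType D₂) (Ψ : C₁ ≌ C₂) {X Y : C₁}
    {φ : X ⟶ Y} (hφ : PreFrobenioid.IsStep F₁ φ) : PreFrobenioid.IsStep F₂ (Ψ.functor.map φ) :=
  ⟨isPreStep_map_of_isOfFSMFFType hF₁ hF₂ hi₁ hi₂ hD₂ Ψ hφ.1, fun h => hφ.2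
    (by haveI := h; exact Ψ.fullyFaithfulFunctor.isIso_of_isIso_map φ)⟩

/-- Over bases of FSMFF-type AS PRINTED, quasi-isotropic type, non-dilating divisor monoids, a non-group-like
object on each side: `Ψ` is Frobenius-compatible (twin of `isFrobeniusCompatible_of_isOfFSMFFType2024`).
[cite: MochizukiFrdI2008, Thm. 3.4 (iii) p.62] -/
theorem isFrobeniusCompatible_of_isOfFSMFFType (hF₁ : PreFrobenioid.IsFrobenioid F₁)
    (hF₂ : PreFrobenioid.IsFrobenioid F₂) (hq₁ : (PreFrobenioidData.ofFunctor Φ₁ F₁).IsOfQuasiIsotropicType)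
    (hq₂ : (PreFrobenioidData.ofFunctor Φ₂ F₂).IsOfQuasiIsotropicType) (hD₁ : IsOfFSMFFType D₁)
    (hD₂ : IsOfFSMFFType D₂) (hnd₁ : (PreFrobenioidData.ofFunctor Φ₁ F₁).IsNonDilatingOn)
    (hnd₂ : (PreFrobenioidData.ofFunctor Φ₂ F₂).IsNonDilatingOn) (Ψ : C₁ ≌ C₂)
    (hN₁ : ∃ A : C₁, ¬ (PreFrobenioidData.ofFunctor Φ₁ F₁).IsGroupLikeObj A)
    (hN₂ : ∃ A : C₂, ¬ (PreFrobenioidData.ofFunctor Φ₂ F₂).IsGroupLikeObj A) :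
    PreFrobenioid.IsFrobeniusCompatible F₁ F₂ Ψ.functor :=
  isFrobeniusCompatible_of_preservesPreSteps hF₁ hF₂ hq₁ hq₂ hnd₁ hnd₂ Ψ
    (fun _ _ _ hφ => isPreStep_map_of_quasiIsotropic_of_isOfFSMFFType hF₁ hF₂ hq₁ hq₂ hD₂ Ψ hφ)
    (fun _ _ _ hφ => isPreStep_map_of_quasiIsotropic_of_isOfFSMFFType hF₂ hF₁ hq₂ hq₁ hD₁ Ψ.symm hφ)
    hN₁ hN₂

/-- **Theorem 3.4 (iii), perfection square, over bases of FSMFF-type AS PRINTED** (twin of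
`thm34iii_pfSquare_of_isOfFSMFFType2024`): `Ψ^pf : C₁^pf ⥲ C₂^pf` exists, is an equivalence and `1`-commutes
with `C_i → C_i^pf`. [cite: MochizukiFrdI2008, Thm. 3.4 (iii) p.62] -/
theorem thm34iii_pfSquare_of_isOfFSMFFType (hF₁ : PreFrobenioid.IsFrobenioid F₁)
    (hF₂ : PreFrobenioid.IsFrobenioid F₂) (hq₁ : (PreFrobenioidData.ofFunctor Φ₁ F₁).IsOfQuasiIsotropicType)
    (hq₂ : (PreFrobenioidData.ofFunctor Φ₂ F₂).IsOfQuasiIsotropicType) (hD₁ : IsOfFSMFFType D₁)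
    (hD₂ : IsOfFSMFFType D₂) (hnd₁ : (PreFrobenioidData.ofFunctor Φ₁ F₁).IsNonDilatingOn)
    (hnd₂ : (PreFrobenioidData.ofFunctor Φ₂ F₂).IsNonDilatingOn) (Ψ : C₁ ≌ C₂)
    (hN₁ : ∃ A : C₁, ¬ (PreFrobenioidData.ofFunctor Φ₁ F₁).IsGroupLikeObj A)
    (hN₂ : ∃ A : C₂, ¬ (PreFrobenioidData.ofFunctor Φ₂ F₂).IsGroupLikeObj A) :
    ∃ Ψpf : (PreFrobenioidData.perfection hF₁).Pf ⥤ (PreFrobenioidData.perfection hF₂).Pf,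
      Ψpf.IsEquivalence ∧ OneCommutes Ψ.functor (PreFrobenioidData.perfection hF₂).toPf
        (PreFrobenioidData.perfection hF₁).toPf Ψpf :=
  thm34iii_pfSquare_of_preservesPreSteps hF₁ hF₂ hq₁ hq₂ hnd₁ hnd₂ Ψ
    (fun _ _ _ hφ => isPreStep_map_of_quasiIsotropic_of_isOfFSMFFType hF₁ hF₂ hq₁ hq₂ hD₂ Ψ hφ)
    (fun _ _ _ hφ => isPreStep_map_of_quasiIsotropic_of_isOfFSMFFType hF₂ hF₁ hq₂ hq₁ hD₁ Ψ.symm hφ)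
    hN₁ hN₂

/-- The square for THE perfections with the chosen `Ψ^pf = Perfection.map`, over bases of FSMFF-type AS
PRINTED: `Ψ^pf` is an equivalence. [cite: MochizukiFrdI2008, Thm. 3.4 (iii) p.62] -/
theorem perfectionMap_isEquivalence_of_isOfFSMFFType (hF₁ : PreFrobenioid.IsFrobenioid F₁)
    (hF₂ : PreFrobenioid.IsFrobenioid F₂) (hq₁ : (PreFrobenioidData.ofFunctor Φ₁ F₁).IsOfQuasiIsotropicType)
    (hq₂ : (PreFrobenioidData.ofFunctor Φ₂ F₂).IsOfQuasiIsotropicType) (hD₁ : IsOfFSMFFType D₁)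
    (hD₂ : IsOfFSMFFType D₂) (hnd₁ : (PreFrobenioidData.ofFunctor Φ₁ F₁).IsNonDilatingOn)
    (hnd₂ : (PreFrobenioidData.ofFunctor Φ₂ F₂).IsNonDilatingOn) (Ψ : C₁ ≌ C₂)
    (hN₁ : ∃ A : C₁, ¬ (PreFrobenioidData.ofFunctor Φ₁ F₁).IsGroupLikeObj A)
    (hN₂ : ∃ A : C₂, ¬ (PreFrobenioidData.ofFunctor Φ₂ F₂).IsGroupLikeObj A) :
    (PreFrobenioid.Perfection.map (hF₁ := hF₁) (hF₂ := hF₂)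
        (isFrobeniusCompatible_of_isOfFSMFFType hF₁ hF₂ hq₁ hq₂ hD₁ hD₂ hnd₁ hnd₂ Ψ hN₁ hN₂)).IsEquivalence :=
  PreFrobenioid.Perfection.map_isEquivalence Ψ _

end Two

end FrdI

/-! ### Corollary 4.10 AS TYPED at THE birationalizations — no residual input -/

namespace PreFrobenioid

variable {D₁ : Type u} [Category.{v} D₁] {Φ₁ : D₁ᵒᵖ ⥤ CommMonCat.{w}} {C₁ : Type u'}
  [Category.{v'} C₁] {D₂ : Type u} [Category.{v} D₂] {Φ₂ : D₂ᵒᵖ ⥤ CommMonCat.{w}} {C₂ : Type u'}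
  [Category.{v'} C₂] {F₁ : C₁ ⥤ ElemFrobenioid Φ₁} {F₂ : C₂ ⥤ ElemFrobenioid Φ₂}

/-- **[FrdI] Corollary 4.10 AS TYPED at THE birationalizations `biratData hF_i hsq_i`, for every pair of
Frobenioids and every equivalence — its printed antecedents (FSMFF-type 2008, quasi-isotropic type) are
consumed, nothing else is assumed** (over `cor410_biratData`; Thm. 3.4 (ii) co-angular pre-steps from
`FrdI.isCoAngularPreStep_map_of_quasiIsotropic_of_isOfFSMFFType`). [cite: MochizukiFrdI2008, Cor. 4.10 p.90] -/
theorem cor410_biratData_asPrinted (hF₁ : IsFrobenioid F₁) (hsq₁ : HasBiratSquares F₁)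
    (hF₂ : IsFrobenioid F₂) (hsq₂ : HasBiratSquares F₂) (Ψ : C₁ ≌ C₂) :
    PreFrobenioidData.Cor410 (PreFrobenioidData.ofFunctor Φ₁ F₁) (PreFrobenioidData.ofFunctor Φ₂ F₂) Ψ
      (biratData hF₁ hsq₁) (biratData hF₂ hsq₂) := by
  intro hff₁ hff₂ hq₁ hq₂
  exact cor410_biratData hF₁ hsq₁ hF₂ hsq₂ Ψ
    (fun _ _ _ hf =>
      FrdI.isCoAngularPreStep_map_of_quasiIsotropic_of_isOfFSMFFType hF₁ hF₂ hq₁ hq₂ hff₂ Ψ hf)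
    (fun _ _ _ hf =>
      FrdI.isCoAngularPreStep_map_of_quasiIsotropic_of_isOfFSMFFType hF₂ hF₁ hq₂ hq₁ hff₁ Ψ.symm hf)
    hff₁ hff₂ hq₁ hq₂

end PreFrobenioid

end Literature.AlgebraicGeometry.Frobenioids
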